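import Summits.Langlands.Langlands.Theses.CyclicLayerPeeling
import Literature.NumberTheory.Automorphic.ReciprocityGLnRestrictionProofs
import Literature.NumberTheory.Automorphic.BaseChangeGLnProofs
import Literature.NumberTheory.GaloisRepresentations.RestrictFieldSemisimple
import Summits.Langlands.Langlands.Theses.GaloisHullLift

/-! BC3 birth skeleton for `PerfectHullDescent` (node `GaloisHullLift`, lens-4 g24; DECLARED RESIDUAL — exempt from T3/T4, skeleton filed anyway).  PRE-BIRTH form: the residual is
restated here by its filed text (def `PerfectHullDescent` below = route item verbatim); after birth swap it for the route decl `Summit.Langlands.Langlands.Theses.GaloisHullLift.PerfectHullDescent` (same text) and publish as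
`Cruxes/PerfectHullDescent/Lines/birth.lean`.  Stubs carry `sorry` (registered); the composition `perfectHullDescent_of` is a REAL proof (cases on `n = 1`).
`stub_rankOne` (n = 1: π is an L-algebraic Hecke character of K; its ℓ-adic avatar EXISTS by class field theory + Weil (type A₀ characters), so the conclusion holds
outright and the relative avatar r along the perfect layer is not even needed — INSIDE S's known regime, declared as such; size M once the tree's GL₁ reciprocity
fact is located/typed) and `stub_higherRank` (n ≥ 2, the hardest stub = the dark core proper: relative-avatar descent along a Galois layer with non-trivial PERFECT
group; no character to twist by, H²(Gal(L/K), ℚ̄_ℓ^×) may be non-zero (A₅: ℤ/2), no mechanism in print — Taylor 2006 descends only virtually, Dieulefait 2012 uses (A)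
for π known). -/

set_option linter.dupNamespace false
set_option linter.unusedVariables false

open scoped BigOperators Topology Manifold Classical MeasureTheory ProbabilityTheory Matrix InnerProductSpace ComplexConjugate ContinuousMap
open Filter Set Function TopologicalSpace MeasureTheory

namespace Summit.Langlands.Langlands.Cruxes.PerfectHullDescent.Birth

-- POST-BIRTH form: the local restated `def PerfectHullDescent` of the pre-birth kit is removed; stubs unchanged; ONE closed theorem `PerfectHullDescent_proof` concludes the ROUTE DECL by name.

/-- stub P1 · RANK ONE (inside S's known regime: CFT + Weil give the avatar of an algebraic Hecke character outright). -/
theorem stub_rankOne :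
    ∀ (K : Type) [Field K] [NumberField K] (n : ℕ) (hcpt : Literature.NumberTheory.Automorphic.isCompact_glFiniteIntegralLevel n K), 0 < n → n = 1 → ∀ (π : Literature.NumberTheory.Automorphic.CuspidalAutomorphicRepData n K hcpt), π.1.IsLAlgebraic → ∀ (L : Type) [Field L] [NumberField L] [Algebra K L], IsGalois K L → Module.finrank K L ≠ 1 → (¬ ∃ F : IntermediateField K L, F ≠ ⊥ ∧ IsGalois K ↥F ∧ IsCyclic (↥F ≃ₐ[K] ↥F) ∧ (Module.finrank K ↥F).Prime) → ∀ (ℓ : ℕ) [Fact ℓ.Prime] (ι : PadicAlgCl ℓ ≃+* ℂ) (r : Literature.NumberTheory.GaloisRepresentations.FramedGaloisRep L (PadicAlgCl ℓ) n), r.toGaloisRep.IsSemisimple → (∀ᶠ w : IsDedekindDomain.HeightOneSpectrum (NumberField.RingOfIntegers L) in cofinite, ∀ (v : IsDedekindDomain.HeightOneSpectrum (NumberField.RingOfIntegers K)) (α : Multiset ℂ), w.asIdeal.under (NumberField.RingOfIntegers K) = v.asIdeal → π.1.HasSatakeParamAt v α → r.IsUnramifiedAt w ∧ r.HasFrobCharpolyAt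 w (Literature.NumberTheory.Automorphic.arithFrobPolyOfSatake ι w.residueCard 1 (α.map (fun a => a ^ w.asIdeal.inertiaDeg (NumberField.RingOfIntegers K))))) → ∃ ρ : Literature.NumberTheory.GaloisRepresentations.FramedGaloisRep K (PadicAlgCl ℓ) n, ρ.toGaloisRep.IsSemisimple ∧ ∀ᶠ v : IsDedekindDomain.HeightOneSpectrum (NumberField.RingOfIntegers K) in cofinite, SatakeFrobCompatibleAt ι π.1 ρ v := by
  sorry

/-- stub P2 · HIGHER RANK (hardest; the dark core): n ≥ 2, Gal(L/K) perfect ≠ 1. -/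
theorem stub_higherRank :
    ∀ (K : Type) [Field K] [NumberField K] (n : ℕ) (hcpt : Literature.NumberTheory.Automorphic.isCompact_glFiniteIntegralLevel n K), 0 < n → n ≠ 1 → ∀ (π : Literature.NumberTheory.Automorphic.CuspidalAutomorphicRepData n K hcpt), π.1.IsLAlgebraic → ∀ (L : Type) [Field L] [NumberField L] [Algebra K L], IsGalois K L → Module.finrank K L ≠ 1 → (¬ ∃ F : IntermediateField K L, F ≠ ⊥ ∧ IsGalois K ↥F ∧ IsCyclic (↥F ≃ₐ[K] ↥F) ∧ (Module.finrank K ↥F).Prime) → ∀ (ℓ : ℕ) [Fact ℓ.Prime] (ι : PadicAlgCl ℓ ≃+* ℂ) (r : Literature.NumberTheory.GaloisRepresentations.FramedGaloisRep L (PadicAlgCl ℓ) n), r.toGaloisRep.IsSemisimple → (∀ᶠ w : IsDedekindDomain.HeightOneSpectrum (NumberField.RingOfIntegers L) in cofinite, ∀ (v : IsDedekindDomain.HeightOneSpectrum (NumberField.RingOfIntegers K)) (α : Multiset ℂ), w.asIdeal.under (NumberField.RingOfIntegers K) = v.asIdeal → π.1.HasSatakeParamAt v α → r.IsUnramifiedAt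 w ∧ r.HasFrobCharpolyAt w (Literature.NumberTheory.Automorphic.arithFrobPolyOfSatake ι w.residueCard 1 (α.map (fun a => a ^ w.asIdeal.inertiaDeg (NumberField.RingOfIntegers K))))) → ∃ ρ : Literature.NumberTheory.GaloisRepresentations.FramedGaloisRep K (PadicAlgCl ℓ) n, ρ.toGaloisRep.IsSemisimple ∧ ∀ᶠ v : IsDedekindDomain.HeightOneSpectrum (NumberField.RingOfIntegers K) in cofinite, SatakeFrobCompatibleAt ι π.1 ρ v := by
  sorry

/-- CLOSED COMPOSITION (post-birth shape, writer-1 WORD (A)(61)): the route decl `Summit.Langlands.Langlands.Theses.GaloisHullLift.PerfectHullDescent` from the registered stubs. -/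
theorem PerfectHullDescent_proof :
    Summit.Langlands.Langlands.Theses.GaloisHullLift.PerfectHullDescent := by
  have h1 := stub_rankOne
  have h2 := stub_higherRank
  intro K _ _ n hcpt hn π hπ L _ _ _ hGal hne hex ℓ _ ι r hr hrel
  by_cases h : n = 1
  · exact h1 K n hcpt hn h π hπ L hGal hne hex ℓ ι r hr hrel
  · exact h2 K n hcpt hn h π hπ L hGal hne hex ℓ ι r hr hrel

end Summit.Langlands.Langlands.Cruxes.PerfectHullDescent.Birth
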